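import Summits.ABC.StewartYu.ArchG3RecLinesKCoins
import HarnessLib

/-!
# The archimedean record `ArchG3Rec` — the k-step families of `LinesClosedK κ c`, file 2/3: THE PIECES OF THE (J)/(C) LINES AGAINST `Z`
# (cell abc-stewartyu, crux r2 `ArchCoreRat` stmt-ABC-20502, line `arch-g3-frame`, seam (B) of `stub_recLinesArch`; plan R50/R50′, seat p4 g10)

Support file (theorems only; no named facts, no definitions).  Unit `M = 2ⁿ·Z`, `1 ≤ κ ≤ 2ⁿ`, sorted weights where marked:

* `kj_γb_Nf`: `γb lev·Nf lev ν' ≤ (n+2)/16·M`, `(γb lev + wl lev)·Nf lev ν' ≤ (n+4)/16·M` (`ν' ≤ n`), `γb lev ≤ Z/512`;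
* `kj_schwarz`: the Schwarz constant's log `log(2·(2Nf+1)^{T+1}·T·(20e)^{(2Nf+1)T}) ≤ 6M` (no `log L`: the caps of `Xs`);
* `kj_TlogCRK` (sorted weights, κ-twin `log_CRK_le`): `T lev·log(2·CRK κ lev) ≤ Z`;
* `kj_aT`: `a·log 2 + T lev ≤ Z/2` (`a < Tf lev (ν+1)`); `kj_cUR`: `cUR ≤ Z/8` (p1's `cUR_le`);
* (private) `logDΔC_leK` — the κ-twin of p1 g11's `logDΔC_le` (`n!` ↦ `κ·n`): `log DΔC(YRK κ lev, Tf lev' ν') ≤ Tf lev' ν'·(WN + log N + log(κn) +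
  3·log(n+2) + 1)`; `kj_logDΔC`: `… ≤ Z` (`n ≥ 2`).

## References
* [Nesterenko2003] Yu. V. Nesterenko, LNM 1819 (2003) — §3.5 (3.36)–(3.37); §4.2 (4.24)–(4.35), Lemma 4.3.
* [Matveev2000] E. M. Matveev, Izv. Math. 64 (2000), §3.
-/

noncomputable section

open Finset Real
open scoped Nat
open Summit.ABC.StewartYu.ArchSupply (WC)
open Summit.ABC.StewartYu.ArchG3Setup (DΔC)

namespace Summit.ABC.StewartYu

namespace ArchG3Rec

open PadicG3Par (Cb Cb_pos)
open ArchG3Par (G K yloadK G_eq G_pos K_pos yloadK_pos eight_le_G)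

variable {n : ℕ} (P : ArchG3Rec n)

/-- **`γb lev·Nf lev ν' ≤ (n+2)/16·2ⁿZ`**, **`(γb lev + wl lev)·Nf lev ν' ≤ (n+4)/16·2ⁿZ`** (`ν' ≤ n`; the `2^lev` of the node count
cancels against the slab weights), and `γb lev ≤ Z/512`. [cite: Matveev2000, §3; shape only] -/
theorem kj_γb_Nf (lev ν' : ℕ) (hν' : ν' ≤ n) :
    P.γb lev * P.Nf lev ν' ≤ ((n : ℝ) + 2) / 16 * (2 ^ n * P.Z) ∧
    (P.γb lev + P.wl lev) * P.Nf lev ν' ≤ ((n : ℝ) + 4) / 16 * (2 ^ n * P.Z) ∧ P.γb lev ≤ P.Z / 512 := by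
  obtain ⟨hw0, hw, hg0, hg⟩ := P.kj_γb lev
  obtain ⟨-, -, -, hNf, -⟩ := P.kj_nodes lev ν'
  obtain ⟨hZ0, hLZ, -, hXL, -⟩ := P.kj_units
  have h2ν : (2 : ℝ) ^ ν' ≤ 2 ^ n := pow_le_pow_right₀ (by norm_num) hν'
  have hXL0 : 0 ≤ (P.X : ℝ) * P.L := by positivity
  have hn0 : (0 : ℝ) ≤ n := Nat.cast_nonneg n
  have key : ∀ {g C : ℝ}, 0 ≤ C → 0 ≤ g → g ≤ C * P.L / 2 ^ lev → g * P.Nf lev ν' ≤ C * (2 ^ n * ((P.X : ℝ) * P.L)) := by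
    intro g C hC hg0' hg'
    calc g * P.Nf lev ν' ≤ (C * P.L / 2 ^ lev) * (2 ^ (ν' + lev) * P.X) := mul_le_mul hg' hNf (by positivity) (by positivity)
      _ = C * (2 ^ ν' * ((P.X : ℝ) * P.L)) := by rw [pow_add]; field_simp
      _ ≤ C * (2 ^ n * ((P.X : ℝ) * P.L)) := by gcongr
  have h1 := key (by positivity : (0 : ℝ) ≤ (n : ℝ) / 2 + 1) hg0 hg
  have hgw : P.γb lev + P.wl lev ≤ ((n : ℝ) / 2 + 2) * P.L / 2 ^ lev := by
    have : ((n : ℝ) / 2 + 2) * P.L / 2 ^ lev = ((n : ℝ) / 2 + 1) * P.L / 2 ^ lev + P.L / 2 ^ lev := by ring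
    rw [this]; linarith
  have h2 := key (by positivity : (0 : ℝ) ≤ (n : ℝ) / 2 + 2) (by linarith) hgw
  have hXLZ : 2 ^ n * ((P.X : ℝ) * P.L) ≤ 2 ^ n * (P.Z / 8) := mul_le_mul_of_nonneg_left hXL (by positivity)
  refine ⟨?_, ?_, ?_⟩
  · calc P.γb lev * P.Nf lev ν' ≤ ((n : ℝ) / 2 + 1) * (2 ^ n * ((P.X : ℝ) * P.L)) := h1
      _ ≤ ((n : ℝ) / 2 + 1) * (2 ^ n * (P.Z / 8)) := mul_le_mul_of_nonneg_left hXLZ (by positivity)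
      _ = ((n : ℝ) + 2) / 16 * (2 ^ n * P.Z) := by ring
  · calc (P.γb lev + P.wl lev) * P.Nf lev ν' ≤ ((n : ℝ) / 2 + 2) * (2 ^ n * ((P.X : ℝ) * P.L)) := h2
      _ ≤ ((n : ℝ) / 2 + 2) * (2 ^ n * (P.Z / 8)) := mul_le_mul_of_nonneg_left hXLZ (by positivity)
      _ = ((n : ℝ) + 4) / 16 * (2 ^ n * P.Z) := by ring
  · have h3 : P.γb lev ≤ ((n : ℝ) / 2 + 1) * P.L := by
      calc P.γb lev ≤ ((n : ℝ) / 2 + 1) * P.L / 2 ^ lev := hg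
        _ ≤ ((n : ℝ) / 2 + 1) * P.L := div_le_self (by positivity) (one_le_pow₀ (by norm_num))
    have h4 : ((n : ℝ) / 2 + 1) * P.L ≤ ((n : ℝ) / 2 + 1) * (P.Z / (512 * ((n : ℝ) + 1) ^ 2)) :=
      mul_le_mul_of_nonneg_left hLZ (by positivity)
    have h5 : ((n : ℝ) / 2 + 1) * (P.Z / (512 * ((n : ℝ) + 1) ^ 2)) ≤ P.Z / 512 := by
      rw [mul_div_assoc', div_le_div_iff₀ (by positivity) (by norm_num)]
      nlinarith [mul_nonneg hZ0.le (show (0 : ℝ) ≤ ((n : ℝ) + 1) ^ 2 - ((n : ℝ) / 2 + 1) by nlinarith)]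
    linarith

/-- **the Schwarz constant's log**: `log(2·(2Nf+1)^{T+1}·T·(20e)^{(2Nf+1)T}) ≤ 6·2ⁿ·Z` (`Nf·T ≤ 2^ν(4XL + T + 1)` by the second cap,
`log(2Nf+1) ≤ (n+2+lev)·log 2 + log X` by the first; no `log L`). [cite: Nesterenko2003, §4.2 (4.27); shape only] -/
theorem kj_schwarz {lev ν : ℕ} (hlev : lev ≤ P.Sd) (hν : ν ≤ n) :
    Real.log (2 * ((2 * P.Nf lev ν + 1 : ℕ) : ℝ) ^ (P.T lev + 1) * P.T lev * (20 * Real.exp 1) ^ ((2 * P.Nf lev ν + 1) * P.T lev)) ≤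
      6 * (2 ^ n * P.Z) := by
  obtain ⟨hZ0, -, -, hXL, -⟩ := P.kj_units
  obtain ⟨h16, hnZ, h2Z, h2n, hL512, hL10, hX, -, -⟩ := P.kj_units2
  obtain ⟨hT1, hT8, -, hTs⟩ := P.kj_T lev
  obtain ⟨-, -, hNf1, hNf, hNfT⟩ := P.kj_nodes lev ν
  obtain ⟨-, hlevL⟩ := P.kj_Sd hlev
  obtain ⟨-, hlogX, -, -, hlogX0⟩ := P.log_letters_le
  have hX1 : (1 : ℝ) ≤ P.X := by have := P.X_floors.2.1; linarith
  have hL0 : (0 : ℝ) ≤ P.L := Nat.cast_nonneg _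
  have hn0 : (0 : ℝ) ≤ n := Nat.cast_nonneg n
  have hlev0 : (0 : ℝ) ≤ lev := Nat.cast_nonneg lev
  have hNf0 : (0 : ℝ) ≤ P.Nf lev ν := Nat.cast_nonneg _
  have hApos : (0 : ℝ) < ((2 * P.Nf lev ν + 1 : ℕ) : ℝ) := by positivity
  have hTpos : (0 : ℝ) < P.T lev := by linarith
  have hl2 : Real.log 2 ≤ 1 := by have := Real.log_two_lt_d9; linarith
  have hlD : Real.log (20 * Real.exp 1) ≤ 4 := by
    rw [Real.log_mul (by norm_num) (Real.exp_pos 1).ne', Real.log_exp]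
    have h3 : Real.exp 3 = Real.exp 1 ^ 3 := by rw [← Real.exp_nat_mul]; norm_num
    have h : (20 : ℝ) ≤ Real.exp 3 := by
      rw [h3]
      calc (20 : ℝ) ≤ (2.7182818283 : ℝ) ^ 3 := by norm_num
        _ ≤ Real.exp 1 ^ 3 := pow_le_pow_left₀ (by norm_num) Real.exp_one_gt_d9.le 3
    have : Real.log 20 ≤ 3 := by
      calc Real.log 20 ≤ Real.log (Real.exp 3) := Real.log_le_log (by norm_num) h
        _ = 3 := Real.log_exp 3
    linarith
  -- `log(2Nf+1) ≤ (n + 2) + lev + X`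
  have hlA : Real.log (((2 * P.Nf lev ν + 1 : ℕ) : ℝ)) ≤ (n : ℝ) + 2 + lev + P.X := by
    have h2p : (1 : ℝ) ≤ 2 ^ (ν + lev) := one_le_pow₀ (by norm_num)
    have hA : ((2 * P.Nf lev ν + 1 : ℕ) : ℝ) ≤ 2 ^ (ν + lev + 2) * P.X := by
      push_cast
      have e : (2 : ℝ) ^ (ν + lev + 2) = 4 * 2 ^ (ν + lev) := by rw [pow_add]; ring
      rw [e]; nlinarith
    have hν' : (ν : ℝ) ≤ n := by exact_mod_cast hν
    calc Real.log (((2 * P.Nf lev ν + 1 : ℕ) : ℝ)) ≤ Real.log (2 ^ (ν + lev + 2) * P.X) := Real.log_le_log hApos hA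
      _ = ((ν + lev + 2 : ℕ) : ℝ) * Real.log 2 + Real.log P.X := by
          rw [Real.log_mul (by positivity) (by linarith), Real.log_pow]
      _ ≤ (n : ℝ) + 2 + lev + P.X := by
          push_cast
          have h0 : (0 : ℝ) ≤ (ν : ℝ) + lev + 2 := by positivity
          nlinarith
  have hlT : Real.log (P.T lev : ℝ) ≤ P.T lev := by linarith [Real.log_le_sub_one_of_pos hTpos]
  rw [Real.log_mul (by positivity) (by positivity), Real.log_mul (by positivity) hTpos.ne',
    Real.log_mul (by norm_num) (by positivity), Real.log_pow, Real.log_pow]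
  push_cast
  -- the four pieces
  have hB1 : ((P.T lev : ℝ) + 1) * Real.log (2 * (P.Nf lev ν : ℝ) + 1) ≤ ((P.T lev : ℝ) + 1) * ((n : ℝ) + 2 + lev + P.X) := by
    have : Real.log (2 * (P.Nf lev ν : ℝ) + 1) ≤ (n : ℝ) + 2 + lev + P.X := by push_cast at hlA; exact hlA
    exact mul_le_mul_of_nonneg_left this (by linarith)
  have hB2 : (2 * (P.Nf lev ν : ℝ) + 1) * P.T lev * Real.log (20 * Real.exp 1) ≤ (2 * (P.Nf lev ν : ℝ) + 1) * P.T lev * 4 :=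
    mul_le_mul_of_nonneg_left hlD (by positivity)
  have h2ν : (2 : ℝ) ^ ν ≤ 2 ^ n := pow_le_pow_right₀ (by norm_num) hν
  have hB3 : (P.Nf lev ν : ℝ) * P.T lev ≤ 2 ^ n * (4 * ((P.X : ℝ) * P.L) + P.T lev + 1) := by
    have h1 : (P.Nf lev ν : ℝ) * P.T lev ≤ (P.Nf lev ν : ℝ) * (P.T lev + 1) := by nlinarith
    have h0 : (0 : ℝ) ≤ 4 * (P.X : ℝ) * P.L + P.T lev + 1 := by positivity
    calc (P.Nf lev ν : ℝ) * P.T lev ≤ 2 ^ ν * (4 * P.X * P.L + P.T lev + 1) := h1.trans hNfT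
      _ ≤ 2 ^ n * (4 * P.X * P.L + P.T lev + 1) := mul_le_mul_of_nonneg_right h2ν h0
      _ = 2 ^ n * (4 * ((P.X : ℝ) * P.L) + P.T lev + 1) := by ring
  have hB4 : (P.T lev : ℝ) * ((n : ℝ) + 2) ≤ 8 * P.L * ((n : ℝ) + 2) := mul_le_mul_of_nonneg_right hT8 (by positivity)
  have hB5 : (P.T lev : ℝ) * P.X ≤ 8 * ((P.X : ℝ) * P.L) := by nlinarith
  have h2n0 : (0 : ℝ) ≤ 2 ^ n := by positivity
  have hC1 : 2 ^ n * ((P.X : ℝ) * P.L) ≤ 2 ^ n * (P.Z / 8) := mul_le_mul_of_nonneg_left hXL h2n0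
  have hC2 : 2 ^ n * (P.T lev : ℝ) ≤ 2 ^ n * (8 * P.L) := mul_le_mul_of_nonneg_left hT8 h2n0
  have hC3 : 2 ^ n * (P.L : ℝ) ≤ 2 ^ n * (P.Z / 512) := mul_le_mul_of_nonneg_left hL512 h2n0
  linarith [hB1, hB2, hB3, hB4, hB5, hC1, hC2, hC3, hTs, hlevL, hlT, hl2, h16, hX, hL10, hL512, h2n, hZ0, h2Z, hXL, hn0,
    hlev0, hT1]

/-- **the jets radius against `Z`**: `T lev·log(2·CRK κ lev) ≤ Z` (sorted weights; `log(1+x) ≤ log 2 + log x`,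
`log Bexp = W − 1`, `T·lev ≤ 8L + lev`). [cite: Nesterenko2003, §4.2 Lemma 4.3; shape only] -/
theorem kj_TlogCRK (κ : ℕ) (hκ : 1 ≤ κ) (hκ2 : (κ : ℝ) ≤ 2 ^ n) (hmono : Monotone P.A) {lev : ℕ} (hlev : lev ≤ P.Sd) :
    (P.T lev : ℝ) * Real.log (2 * P.CRK κ lev) ≤ P.Z := by
  obtain ⟨-, hC⟩ := P.log_CRK_le κ hκ hmono lev
  obtain ⟨hZ0, -, hLWN, -, -⟩ := P.kj_units
  obtain ⟨h16, hnZ, h2Z, h2n, hL512, hL10, hX, hWNZ, -⟩ := P.kj_units2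
  obtain ⟨hT1, hT8, -, hTs⟩ := P.kj_T lev
  obtain ⟨-, hlevL⟩ := P.kj_Sd hlev
  obtain ⟨hlogN, -, -, hlogκ, hlogn, -, -, hlogN0, hlogκ0⟩ := P.kj_logs κ hκ hκ2
  obtain ⟨hWN1, hWWN, -, -⟩ := P.WN_bounds
  have hB1 : 1 ≤ P.Bexp := P.Alast_facts.2.2.2.2.2
  have hN1 := P.N_facts.2.1
  have hn1 : (1 : ℝ) ≤ n := by exact_mod_cast P.hn
  have hκ1 : (1 : ℝ) ≤ κ := by exact_mod_cast hκ
  have hL0 : (0 : ℝ) ≤ P.L := Nat.cast_nonneg _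
  have hl2 : Real.log 2 ≤ 1 := by have := Real.log_two_lt_d9; linarith
  -- `x := (7/2) n² (κn) Bexp N² 2^lev ≥ 1`
  have hx1 : (1 : ℝ) ≤ 7 / 2 * n ^ 2 * (κ * n) * P.Bexp * P.N ^ 2 * 2 ^ lev := by
    have h1 : (1 : ℝ) ≤ 7 / 2 * n ^ 2 := by nlinarith
    have h2 : (1 : ℝ) ≤ (κ : ℝ) * n := one_le_mul_of_one_le_of_one_le hκ1 hn1
    have h3 : (1 : ℝ) ≤ (P.N : ℝ) ^ 2 := one_le_pow₀ hN1
    have h4 : (1 : ℝ) ≤ (2 : ℝ) ^ lev := one_le_pow₀ (by norm_num)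
    exact one_le_mul_of_one_le_of_one_le (one_le_mul_of_one_le_of_one_le (one_le_mul_of_one_le_of_one_le
      (one_le_mul_of_one_le_of_one_le h1 h2) hB1) h3) h4
  have hlogx : Real.log (7 / 2 * n ^ 2 * (κ * n) * P.Bexp * P.N ^ 2 * 2 ^ lev) ≤ 3 + 4 * n + P.WN + 2 * P.WN + lev := by
    have hB : Real.log P.Bexp = P.W - 1 := by unfold Bexp; rw [Real.log_exp]
    rw [Real.log_mul (by positivity) (by positivity), Real.log_mul (by positivity) (by positivity),
      Real.log_mul (by positivity) (by positivity), Real.log_mul (by positivity) (by positivity),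
      Real.log_mul (by positivity) (by positivity), Real.log_mul (by positivity) (by positivity), Real.log_pow,
      Real.log_pow, Real.log_pow, hB]
    have h72 : Real.log (7 / 2 : ℝ) ≤ 5 / 2 := by
      have : Real.log (7 / 2 : ℝ) ≤ 7 / 2 - 1 := Real.log_le_sub_one_of_pos (by norm_num)
      linarith
    push_cast
    have hlev0 : (0 : ℝ) ≤ lev := Nat.cast_nonneg lev
    have hl : (lev : ℝ) * Real.log 2 ≤ lev := mul_le_of_le_one_right hlev0 hl2
    linarith
  have hlog : Real.log (2 * P.CRK κ lev) ≤ 5 + 4 * n + 3 * P.WN + lev := by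
    have h1 : Real.log (1 + 7 / 2 * n ^ 2 * (κ * n) * P.Bexp * P.N ^ 2 * 2 ^ lev) ≤
        Real.log 2 + Real.log (7 / 2 * n ^ 2 * (κ * n) * P.Bexp * P.N ^ 2 * 2 ^ lev) := by
      rw [← Real.log_mul (by norm_num) (by positivity)]
      exact Real.log_le_log (by positivity) (by linarith)
    linarith
  -- `T·(4 + 4n + 3WN) + T·lev ≤ 8L(4+4n) + 24 L·WN + 8L + lev ≤ Z`
  have hT0 : (0 : ℝ) ≤ P.T lev := by linarith
  have hn0 : (0 : ℝ) ≤ n := Nat.cast_nonneg n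
  have h1 : (P.T lev : ℝ) * Real.log (2 * P.CRK κ lev) ≤ P.T lev * (5 + 4 * n + 3 * P.WN + lev) := mul_le_mul_of_nonneg_left hlog hT0
  have h2 : (P.T lev : ℝ) * (5 + 4 * n) ≤ 8 * P.L * (5 + 4 * n) := mul_le_mul_of_nonneg_right hT8 (by positivity)
  have h3 : (P.T lev : ℝ) * P.WN ≤ 8 * P.L * P.WN := mul_le_mul_of_nonneg_right hT8 (by linarith)
  -- `L·WN ≤ Z/(64(n+1)) ≤ Z/64`, `(32n+48)·L ≤ Z/8`
  obtain ⟨h4, -, h5⟩ := P.kj_LWN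
  linarith [h1, h2, h3, h4, h5, hTs, hlevL, hL512]

/-- `a·log 2 + T lev ≤ Z/2` for `a < Tf lev (ν+1) ≤ Tf 0 0 ≤ (33/2)(n+1)L`. [folklore] -/
theorem kj_aT (hn2 : 2 ≤ n) (lev ν : ℕ) {a : ℕ} (ha : a < P.Tf lev (ν + 1)) : (a : ℝ) * Real.log 2 + P.T lev ≤ P.Z / 2 := by
  have haT : (a : ℝ) ≤ P.Tf 0 0 := by exact_mod_cast (ha.le.trans (P.Tf_le_Tf00 lev (ν + 1)))
  have hT00 := P.Tf00_le hn2
  obtain ⟨-, hT8, -, -⟩ := P.kj_T lev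
  obtain ⟨-, -, -, -, -, hL10, -⟩ := P.kj_units2
  have hl2 : Real.log 2 ≤ 1 := by have := Real.log_two_lt_d9; linarith
  have ha0 : (0 : ℝ) ≤ a := Nat.cast_nonneg a
  have hL0 : (0 : ℝ) ≤ P.L := Nat.cast_nonneg _
  have hn0 : (0 : ℝ) ≤ n := Nat.cast_nonneg n
  have h1 : (a : ℝ) * Real.log 2 ≤ a := mul_le_of_le_one_right ha0 hl2
  linarith

/-- `cUR ≤ Z/8` (from p1's `cUR_le`, `yload_K ≥ 50`, `n·WN ≤ Z/2^31`). [folklore] -/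
theorem kj_cUR : P.cUR ≤ P.Z / 8 := by
  obtain ⟨hc, -⟩ := P.cUR_le
  obtain ⟨hZ0, -, -, -, hWN, -⟩ := P.kj_units
  obtain ⟨h16, hnZ, -, h2n, hL512, hL10, hX, -, -⟩ := P.kj_units2
  have hy := yloadK_ge P.hn
  have hG := eight_le_G n
  have hy50 : (50 : ℝ) ≤ yloadK n := by linarith
  have h1 : P.Z / (4 * yloadK n) ≤ P.Z / 200 := div_le_div_of_nonneg_left hZ0.le (by norm_num) (by linarith)
  have hn0 : (0 : ℝ) ≤ n := Nat.cast_nonneg n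
  have hn2n : (n : ℝ) ≤ 2 ^ n := by exact_mod_cast Nat.lt_two_pow_self.le
  -- `n·WN ≤ 2^n·Z/2^{n+31} = Z/2^31`
  have h2 : (n : ℝ) * P.WN ≤ P.Z / 2 ^ 31 := by
    have hWN0 := P.WN_bounds.2.2.2
    calc (n : ℝ) * P.WN ≤ 2 ^ n * (P.Z / 2 ^ (n + 31)) := mul_le_mul hn2n hWN hWN0.le (by positivity)
      _ = P.Z / 2 ^ 31 := by rw [pow_add]; field_simp
  have hL0 : (0 : ℝ) ≤ P.L := Nat.cast_nonneg _
  linarith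

/-- (private; the letter-sheet name is p1 g11's `logDΔCK_le`) **κ-twin of p1's `logDΔC_le`**: `log DΔC(YRK κ lev, Tf lev' ν') ≤ Tf lev' ν'·(WN + log N + log(κ·n) + 3·log(n+2) + 1)`
(`Tf ≥ 8(n+1)L/(n+2)³`, `YRK ≤ 10·n·(κn)·Bexp·N²·L`, so `1 + YRK/Tf ≤ (9/4)(n+2)³·(κn)·Bexp·N²`, `log Bexp = W − 1`). p1 g11's proof
with `n!` ↦ `κ·n`. [cite: Nesterenko2003, (3.37); shape only] -/
private theorem logDΔC_leK (κ : ℕ) (hκ : 1 ≤ κ) (lev lev' ν' : ℕ) : Real.log (DΔC (P.YRK κ lev) (P.Tf lev' ν')) ≤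
    P.Tf lev' ν' * (P.WN + Real.log P.N + Real.log ((κ : ℝ) * n) + 3 * Real.log ((n : ℝ) + 2) + 1) := by
  obtain ⟨hY0, hY⟩ := P.YRK_le κ hκ lev
  obtain ⟨hT8, hT1⟩ := P.Tf_ge lev' ν'
  have hN := P.N_facts
  have hL := P.L_real
  rw [ArchG3Setup.log_DΔC hY0]
  have hT0 : (0 : ℝ) < P.Tf lev' ν' := by linarith
  have hn0 : (0 : ℝ) ≤ n := Nat.cast_nonneg n
  have hn1 : (1 : ℝ) ≤ n := by exact_mod_cast P.hn
  have hf1 : (1 : ℝ) ≤ (κ : ℝ) * n := (kappa_pred_le hκ P.hn).2.2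
  have hB : Real.log P.Bexp = P.W - 1 := by unfold Bexp; rw [Real.log_exp]
  have hB1 : 1 ≤ P.Bexp := P.Alast_facts.2.2.2.2.2
  have hq : P.YRK κ lev / P.Tf lev' ν' ≤ 5 / 4 * ((n : ℝ) + 2) ^ 3 * (κ * n) * P.Bexp * P.N ^ 2 := by
    rw [div_le_iff₀ hT0]
    have hc : (0 : ℝ) ≤ 5 / 4 * ((n : ℝ) + 2) ^ 3 * (κ * n) * P.Bexp * P.N ^ 2 := by positivity
    have h2 := mul_le_mul_of_nonneg_left hT8 hc
    have h3 : 10 * (n : ℝ) * (κ * n) * P.Bexp * P.N ^ 2 * P.L * ((n : ℝ) + 2) ^ 3 ≤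
        5 / 4 * ((n : ℝ) + 2) ^ 3 * (κ * n) * P.Bexp * P.N ^ 2 * (8 * ((n : ℝ) + 1) * P.L) := by
      have : 10 * (n : ℝ) ≤ 5 / 4 * (8 * ((n : ℝ) + 1)) := by linarith
      have hc2 : (0 : ℝ) ≤ (κ * n) * P.Bexp * P.N ^ 2 * P.L * ((n : ℝ) + 2) ^ 3 := by positivity
      nlinarith [mul_le_mul_of_nonneg_right this hc2]
    have hc3 : (0 : ℝ) < ((n : ℝ) + 2) ^ 3 := by positivity
    have h1 : P.YRK κ lev * ((n : ℝ) + 2) ^ 3 ≤ 10 * n * (κ * n) * P.Bexp * P.N ^ 2 * P.L * ((n : ℝ) + 2) ^ 3 :=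
      mul_le_mul_of_nonneg_right hY (by positivity)
    nlinarith
  have hbig : (1 : ℝ) ≤ ((n : ℝ) + 2) ^ 3 * (κ * n) * P.Bexp * P.N ^ 2 := by
    have h27 : (1 : ℝ) ≤ ((n : ℝ) + 2) ^ 3 := one_le_pow₀ (by linarith)
    have hN2 : (1 : ℝ) ≤ (P.N : ℝ) ^ 2 := one_le_pow₀ hN.2.1
    exact one_le_mul_of_one_le_of_one_le (one_le_mul_of_one_le_of_one_le (one_le_mul_of_one_le_of_one_le h27 hf1) hB1) hN2
  have h4 : 1 + P.YRK κ lev / P.Tf lev' ν' ≤ 9 / 4 * (((n : ℝ) + 2) ^ 3 * (κ * n) * P.Bexp * P.N ^ 2) := by linarith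
  have h5 : Real.log (1 + P.YRK κ lev / P.Tf lev' ν') ≤
      Real.log (9 / 4) + (3 * Real.log ((n : ℝ) + 2) + Real.log ((κ : ℝ) * n) + (P.W - 1) + 2 * Real.log P.N) := by
    have hpos : 0 < 1 + P.YRK κ lev / P.Tf lev' ν' := by positivity
    calc Real.log (1 + P.YRK κ lev / P.Tf lev' ν') ≤ Real.log (9 / 4 * (((n : ℝ) + 2) ^ 3 * (κ * n) * P.Bexp * P.N ^ 2)) :=
          Real.log_le_log hpos h4
      _ = Real.log (9 / 4) + (3 * Real.log ((n : ℝ) + 2) + Real.log ((κ : ℝ) * n) + (P.W - 1) + 2 * Real.log P.N) := by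
          have hB0 : P.Bexp ≠ 0 := by linarith
          have hn2 : ((n : ℝ) + 2) ^ 3 ≠ 0 := by positivity
          have hf0 : (κ : ℝ) * n ≠ 0 := by positivity
          have hN0 : (P.N : ℝ) ^ 2 ≠ 0 := by have := hN.1; positivity
          rw [Real.log_mul (by norm_num) (by positivity), Real.log_mul (by positivity) hN0,
            Real.log_mul (by positivity) hB0, Real.log_mul hn2 hf0, Real.log_pow, Real.log_pow, hB]; push_cast; ring
  have h94 : Real.log (9 / 4 : ℝ) ≤ 1 := by
    have : Real.log (9 / 4 : ℝ) ≤ 9 / 4 - 1 := Real.log_le_sub_one_of_pos (by norm_num)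
    have h2 : (9 : ℝ) / 4 ≤ Real.exp 1 := by have := Real.exp_one_gt_d9; linarith
    calc Real.log (9 / 4 : ℝ) ≤ Real.log (Real.exp 1) := Real.log_le_log (by norm_num) h2
      _ = 1 := Real.log_exp 1
  have h6 : 1 + Real.log (1 + P.YRK κ lev / P.Tf lev' ν') ≤
      P.WN + Real.log P.N + Real.log ((κ : ℝ) * n) + 3 * Real.log ((n : ℝ) + 2) + 1 := by
    unfold WN; linarith
  exact mul_le_mul_of_nonneg_left h6 hT0.le

/-- `log DΔC(YRK κ lev, Tf lev' ν') ≤ Z` for `1 ≤ κ ≤ 2ⁿ`, `n ≥ 2` (`Tf ≤ (33/2)(n+1)L`, `L·WN ≤ Z/(64(n+1))`). [folklore] -/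
theorem kj_logDΔC (hn2 : 2 ≤ n) (κ : ℕ) (hκ : 1 ≤ κ) (hκ2 : (κ : ℝ) ≤ 2 ^ n) (lev lev' ν' : ℕ) :
    Real.log (DΔC (P.YRK κ lev) (P.Tf lev' ν')) ≤ P.Z := by
  have h := P.logDΔC_leK κ hκ lev lev' ν'
  have hT := (P.Tf_le_Tf00 lev' ν')
  have hT' : (P.Tf lev' ν' : ℝ) ≤ P.Tf 0 0 := by exact_mod_cast hT
  have hT00 := P.Tf00_le hn2
  obtain ⟨hZ0, -, hLWN, -⟩ := P.kj_units
  obtain ⟨-, -, h512, -⟩ := P.Z_floors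
  obtain ⟨hlogN, -, -, hlogκ, hlogn, -, -, hlogN0, hlogκ0⟩ := P.kj_logs κ hκ hκ2
  obtain ⟨hWN1, -, -, -⟩ := P.WN_bounds
  have hn0 : (0 : ℝ) ≤ n := Nat.cast_nonneg n
  have hn1 : (1 : ℝ) ≤ n := by exact_mod_cast P.hn
  have hκ0 : (0 : ℝ) < κ := by exact_mod_cast hκ
  have hL0 : (0 : ℝ) ≤ P.L := Nat.cast_nonneg _
  have hlogκn : Real.log ((κ : ℝ) * n) ≤ 2 * n := by
    rw [Real.log_mul hκ0.ne' (by positivity)]; linarith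
  have hlogn2 : Real.log ((n : ℝ) + 2) ≤ (n : ℝ) + 1 := by linarith [Real.log_le_sub_one_of_pos (show (0:ℝ) < (n:ℝ) + 2 by positivity)]
  have hbr : P.WN + Real.log P.N + Real.log ((κ : ℝ) * n) + 3 * Real.log ((n : ℝ) + 2) + 1 ≤ 2 * P.WN + 5 * n + 4 := by linarith
  have hT0 : (0 : ℝ) ≤ P.Tf lev' ν' := Nat.cast_nonneg _
  have hbr0 : 0 ≤ P.WN + Real.log P.N + Real.log ((κ : ℝ) * n) + 3 * Real.log ((n : ℝ) + 2) + 1 := by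
    have h1 : 0 ≤ Real.log ((κ : ℝ) * n) := Real.log_nonneg (one_le_mul_of_one_le_of_one_le (by exact_mod_cast hκ) hn1)
    have h2 : 0 ≤ Real.log ((n : ℝ) + 2) := Real.log_nonneg (by linarith)
    linarith
  have h1 : (P.Tf lev' ν' : ℝ) * (P.WN + Real.log P.N + Real.log ((κ : ℝ) * n) + 3 * Real.log ((n : ℝ) + 2) + 1) ≤
      (33 / 2 * ((n : ℝ) + 1) * P.L) * (2 * P.WN + 5 * n + 4) :=
    mul_le_mul (hT'.trans hT00) hbr hbr0 (by positivity)
  -- `33(n+1)L·WN ≤ 33 Z/64`, `(33/2)(n+1)(5n+4) L ≤ (33/2)·5(n+1)² L ≤ (165/1024) Z`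
  have h2 : ((n : ℝ) + 1) * P.L * P.WN ≤ P.Z / 64 := P.kj_LWN.2.1
  have h3' : ((n : ℝ) + 1) * (5 * n + 4) * P.L ≤ 5 * ((n : ℝ) + 1) ^ 2 * P.L := by
    nlinarith [mul_nonneg (show (0 : ℝ) ≤ (n : ℝ) + 1 by positivity) hL0]
  have h3 : ((n : ℝ) + 1) * (5 * n + 4) * P.L ≤ 5 * P.Z / 512 := by
    rw [le_div_iff₀ (by norm_num)]; linarith
  linarith

end ArchG3Rec

end Summit.ABC.StewartYu

end
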